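/-
Copyright: the b2b-balaban T⁴-continuum CRUX team, row NE7b leaf lineage `t4-ne7b-formalise-leaf-05` (gen 152). Project licence.
-/
import Literature.MathematicalPhysics.QuantumFieldTheory.Balaban1983to89.B4Ineq115Torus
import Literature.MathematicalPhysics.QuantumFieldTheory.Balaban1983to89.QGQInverse
import Mathlib.Analysis.CStarAlgebra.Matrix
import Mathlib.Analysis.InnerProductSpace.Calculus
import Mathlib.Analysis.Calculus.ContDiff.Operations
import Mathlib.Analysis.Convex.Strong

/-!
# THE FIBRE FLOOR `λ` BY VALUE FOR THE SCALAR PROTOTYPE: the Gaussian fluctuation form `½⟨Z, (aL⁻²Q^*Q + Δ^{(j)})Z⟩` of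
# Bałaban's scalar torus tower is `γ₀`-coercive with `γ₀ = gamma115u L a` — [B4] (1.15) ON THE TORUS, a THEOREM of the tree
# (`…Balaban1983to89.B4Ineq115Torus.ineq115`) — at EVERY level `j ≥ 1`, EVERY volume, EVERY cutoff, EVERY `m² ≥ 0`; read in the
# road's three currencies (matrix ∕ operator ∕ Hessian) on the fluctuation field's own index set and, by re-indexing, in the
# `Fin N` currency of `…CoerciveFluctuationFloor` (row NE7b, node U5c; residual (R2′) family (2), letter (ℓ1); kernel lemmas)

Cell `pub-balaban`, sub-cell `t4`, spine estimate NE7b (`T4WeightBudget.RelWeightBound`; the cell's OWN estimate — NOT PRINTED in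
[Bałaban 1983–89], NOT PROVED).  Crux-route work under `Spine/NE7b/`; NOTHING of Bałaban's is asserted: the one analytic input,
(1.15) on the torus for the concrete scalar tower, is a THEOREM of the Literature module `…B4Ineq115Torus`, consumed BY NAME;
no `def`; zero `sorry`; no `T4Continuum/Support` leaf (FREEZE (0)).
Imports: `…B4Ineq115Torus` (`Carg P a msq j = aL⁻²Q^*_jQ_j + Δ^{(j)}` on `Site P j`, `ineq115`), `…QGQInverse` (`Coercive`), Mathlib.

WHY.  The road's one-step displays (`…FibreWindowHessianBounds` §9, `…CoerciveFluctuationFloor` §3–§4, `…FluctuationStepModulus`)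
ask a FIBRE FLOOR: `σ‖v‖² ≤ ⟪v, Av⟫` for the operator `A` of the fibre's quadratic part (OWNER memo `A1C-LCS-RESIDUAL-g109` §2 (ℓ1):
«λ by value remains closed in the RT chart only»; refuter R-AHL-g83-1 (b): «the floor of record is `γ₀` on the MAIN action's Gaussian
fluctuation form»).  For the SCALAR PROTOTYPE that form is `exp(−½⟨Z, C^{(j)−1}Z⟩)`, `C^{(j)−1} = Carg` (`B5Display136Torus.Crs_eq`),
and the tree PROVES (1.15) for it on the torus with a LEVEL-FREE constant: `gamma115u L a · ‖ψ‖² ≤ ⟨ψ, Carg ψ⟩ ≤ (aL⁻² + a)‖ψ‖²`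
(`B4Ineq115Torus.ineq115`).  THIS FILE plugs it in — the (ℓ1) analogue of `…InducedMeanScalarTower` ((R1″) by value, same tower).

WHAT IS PROVED ([folklore] dictionary + the tree's (1.15) by name):
* §1 (any finite index `ι`) `dotProduct_self_eq_norm_sq`, `inner_toEuclideanCLM_symm`, **`coercive_iff_inner`**
  (`QGQInverse.Coercive M γ ↔ ∀ v, γ‖v‖² ≤ ⟪v, M̂ v⟫`, `M̂ = Matrix.toEuclideanCLM M` on `EuclideanSpace ℝ ι`), `inner_le_of_form_le`,
  `coercive_smul_of_nonneg` (`t ≥ 0`: `Coercive (t • M) (tγ)` — the `½` of `½⟨Z, C⁻¹Z⟩`) — `…CoerciveFluctuationFloor` §1 is the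
  `ι = Fin N` instance.
* §2 (any real inner product space `E`) **`iteratedFDeriv_two_quadratic`** (`D²(z ↦ ⟪z, Az⟫)(x)[v, w] = ⟪v, Aw⟫ + ⟪Av, w⟫`, `= 2⟪v, Aw⟫`
  for `A` symmetric), `hessian_quadratic_lower ∕ _upper` (`2σ‖v‖² ≤ D² ≤ 2Γ‖v‖²` everywhere), **`hessianOn_quadratic_add_lower`**
  (`P` `C²` at the points of a window `K` with `−h‖v‖² ≤ D²P` on `K` ⊢ `(2σ − h)‖v‖² ≤ D²(⟪·, A·⟫ + P)` on `K`) —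
  `…CoerciveFluctuationFloor` §2–§3 are the `E = ℝᴺ` instances; `quadratic_chord_identity`, **`strongConvexOn_quadratic`**
  (`σ‖v‖² ≤ ⟪v, Av⟫` ⊢ `StrongConvexOn univ (2σ) ⟪·, A·⟫` — Mathlib's modulus currency, the input of (26) §5 ∕ (27) ∕ (30)).
* §3 (re-indexing) `dotProduct_comp_equiv`, **`coercive_reindex_iff`** (`Coercive (reindex e e M) γ ↔ Coercive M γ`), `form_le_reindex`,
  `isSymm_reindex` — the matrix letters transport along `e : ι ≃ κ`, so a by-value matrix on print's index set feeds the road's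
  `Fin N`-indexed consumers (`…CoerciveFluctuationFloor` §3–§5, `…FibreWindowHessianBounds` §9).
* §4 BY VALUE for the scalar tower (`P : Params`, `0 < a`, `0 ≤ m²`, `1 ≤ j`): **`coercive_Carg`** (`Coercive (Carg P a m² j) (gamma115u L a)`;
  the ceiling `aL⁻² + a` is the tree's `ineq115_upper` itself), `coercive_half_Carg` (`½Carg`, floor `γ₀∕2`); operator currency on `EuclideanSpace ℝ (Site P j)`:
  **`inner_Carg_lower ∕ _upper ∕ _symm`** — the road's `(hσ, hΓ, hA)`; Hessian currency: **`hessian_Carg_lower ∕ _upper`**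
  (`2γ₀‖v‖² ≤ D²⟪·, Ĉ·⟫ ≤ 2(aL⁻² + a)‖v‖²`), **`hessianOn_half_Carg_add_lower`**
  (`(γ₀ − h)‖v‖²` ON a window under a Hessian-small perturbation); secant currency **`strongConvexOn_half_Carg`** (`½Ĉ` is
  `gamma115u L a`-strongly convex: the FIBRE floor in secant currency — first-order fibre letters via (26) §5 ∕ leaf-03's
  `…StrongConvexFirstOrderWithin`; NOT the RG kernel `(aL⁻²∕2)‖ψ − Qφ‖²` of (30), whose modulus `aL⁻²` is read off (0.1)); `Fin N` currency: `coercive_Carg_reindex`, `form_le_Carg_reindex`,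
  `isSymm_Carg_reindex`; print's quantifier order **`fibreFloor_scalarTower_uniform`** (for every odd `L > 1` and `a > 0` THERE IS
  `γ₀ > 0` — `gamma115u L a` — serving every dimension, volume, cutoff, mass `≥ 0` and level `≥ 1`).
* §5 toy (kernel `example`s at a concrete `Params`): the hypotheses are jointly inhabited.

NOT HERE (honest): the GAUGE-covariant forms `C*Δ_k(U)C` of [B13]–[B16] (their `γ₀∕g_k²` floor is [B15] (2.8) ∕ [B9] Sect. E —
G-B9-09 «asserted», G-an2-4; the (A1c) READING); polymer ∕ boundary parts (R-AHL-g83-1 (c)); which window ∕ chart ((A3), NC-NE7b-α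
UNRULED); the END display across the fluctuation integral (= §4 + `…CoerciveFluctuationFloor` §4 + `…FibreWindowHessianBounds` §9).
BY-NAME EFFECT ON THE WALL: NONE (a prototype supplier: (ℓ1) by value for the scalar tower, not for the row's gauge-field instance).
NE7b NOT PRINTED ∕ NOT PROVED; spine PROVED 0∕9; rung (B)+1 on ONE finite T⁴ — NOT infinite volume, NOT the mass gap, NOT Clay.
HONEST DEPENDENCY: continuum YM on T⁴ ⇐ BetaPertH ∧ nine spine estimates (0/9 proved); BetaPertH ⇐ (D1) ∧ (D4) ∧ CAP+tail.
-/

set_option autoImplicit false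
noncomputable section
open Matrix Set
open scoped RealInnerProductSpace
open Literature.MathematicalPhysics.QuantumFieldTheory.Balaban1983to89 (QGQInverse.Coercive)

namespace Summit.QuantumFields.BalabanUV.T4Continuum.NE7b.ScalarTowerFibreFloor

/-! ## §1 The dictionary on any finite index set: matrix currency on `ι → ℝ` ↔ operator currency on `EuclideanSpace ℝ ι` -/

section Dictionary

variable {ι : Type*} [Fintype ι] [DecidableEq ι]

omit [DecidableEq ι] in
/-- `v ⬝ᵥ v = ‖v‖²` for the coordinates of a Euclidean vector. [folklore] -/
theorem dotProduct_self_eq_norm_sq (v : EuclideanSpace ℝ ι) : v ⬝ᵥ v = ‖v‖ ^ 2 := by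
  rw [EuclideanSpace.real_norm_sq_eq, dotProduct]
  exact Finset.sum_congr rfl fun i _ => by ring

/-- The operator of a SYMMETRIC matrix is symmetric in the real inner product: `⟪M̂ v, w⟫ = ⟪v, M̂ w⟫` — the road's `hA` letter. [folklore] -/
theorem inner_toEuclideanCLM_symm {M : Matrix ι ι ℝ} (hM : M.IsSymm) (v w : EuclideanSpace ℝ ι) :
    ⟪toEuclideanCLM (𝕜 := ℝ) M v, w⟫ = ⟪v, toEuclideanCLM (𝕜 := ℝ) M w⟫ := by
  rw [real_inner_comm, inner_toEuclideanCLM, inner_toEuclideanCLM, dotProduct_mulVec, ← mulVec_transpose, hM.eq,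
    dotProduct_comm]

/-- **MATRIX COERCIVITY IS THE ROAD'S OPERATOR LETTER** on any finite index set: `QGQInverse.Coercive M γ` iff
`γ‖v‖² ≤ ⟪v, M̂ v⟫` for every `v : EuclideanSpace ℝ ι` — the `hσ` letter. [folklore] -/
theorem coercive_iff_inner (M : Matrix ι ι ℝ) (γ : ℝ) :
    QGQInverse.Coercive M γ ↔ ∀ v : EuclideanSpace ℝ ι, γ * ‖v‖ ^ 2 ≤ ⟪v, toEuclideanCLM (𝕜 := ℝ) M v⟫ := by
  constructor
  · intro h v
    rw [inner_toEuclideanCLM, ← dotProduct_self_eq_norm_sq]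
    exact h _
  · intro h x
    have hx := h (WithLp.toLp 2 x)
    rw [inner_toEuclideanCLM, ← dotProduct_self_eq_norm_sq] at hx
    simpa using hx

/-- The UPPER form bound `u ⬝ᵥ M u ≤ γ₁·(u ⬝ᵥ u)` is the operator ceiling `⟪v, M̂ v⟫ ≤ γ₁‖v‖²` — the `hΓ` letter. [folklore] -/
theorem inner_le_of_form_le {M : Matrix ι ι ℝ} {γ₁ : ℝ} (h : ∀ u : ι → ℝ, u ⬝ᵥ (M *ᵥ u) ≤ γ₁ * (u ⬝ᵥ u))
    (v : EuclideanSpace ℝ ι) : ⟪v, toEuclideanCLM (𝕜 := ℝ) M v⟫ ≤ γ₁ * ‖v‖ ^ 2 := by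
  rw [inner_toEuclideanCLM, ← dotProduct_self_eq_norm_sq]
  exact h _

omit [DecidableEq ι] in
/-- Scaling by `t ≥ 0`: `Coercive M γ ⟹ Coercive (t • M) (tγ)` (the `½` of the Gaussian exponent `½⟨Z, C⁻¹Z⟩`). [folklore] -/
theorem coercive_smul_of_nonneg {M : Matrix ι ι ℝ} {γ t : ℝ} (ht : 0 ≤ t) (h : QGQInverse.Coercive M γ) :
    QGQInverse.Coercive (t • M) (t * γ) := by
  intro x
  rw [smul_mulVec, dotProduct_smul, smul_eq_mul, mul_assoc]
  exact mul_le_mul_of_nonneg_left (h x) ht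

end Dictionary

/-! ## §2 The quadratic form of a bounded operator in HESSIAN currency, on any real inner product space -/

section Quadratic

variable {E : Type*} [NormedAddCommGroup E] [InnerProductSpace ℝ E]

/-- The derivative of `z ↦ ⟪z, Az⟫` at `z` is `w ↦ ⟪z, Aw⟫ + ⟪Az, w⟫`, packaged as the value at `z` of a continuous linear map
`E →L (E →L ℝ)` (so that the second derivative is that map). [folklore] -/
theorem hasFDerivAt_quadratic (A : E →L[ℝ] E) (z : E) :
    HasFDerivAt (fun z : E => ⟪z, A z⟫)
      ((((ContinuousLinearMap.compL ℝ E E ℝ).flip A).comp (innerSL ℝ) + (innerSL ℝ).comp A) z) z := by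
  have h := (hasFDerivAt_id (𝕜 := ℝ) z).inner ℝ A.hasFDerivAt
  refine h.congr_fderiv (ContinuousLinearMap.ext fun w => ?_)
  simp only [ContinuousLinearMap.coe_comp, Function.comp_apply, fderivInnerCLM_apply, id_eq,
    ContinuousLinearMap.prod_apply, ContinuousLinearMap.coe_id', _root_.add_apply,
    ContinuousLinearMap.flip_apply, ContinuousLinearMap.compL_apply, innerSL_apply_apply, real_inner_comm (A z)]

/-- `D(z ↦ ⟪z, Az⟫) = z ↦ (w ↦ ⟪z, Aw⟫ + ⟪Az, w⟫)`. [folklore] -/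
theorem fderiv_quadratic (A : E →L[ℝ] E) :
    fderiv ℝ (fun z : E => ⟪z, A z⟫) =
      fun z => (((ContinuousLinearMap.compL ℝ E E ℝ).flip A).comp (innerSL ℝ) + (innerSL ℝ).comp A) z :=
  funext fun z => (hasFDerivAt_quadratic A z).fderiv

/-- **THE HESSIAN OF `⟪·, A·⟫`**: `D²(z ↦ ⟪z, Az⟫)(x)[v, w] = ⟪v, Aw⟫ + ⟪Av, w⟫` at every `x`, for any bounded `A`. [folklore] -/
theorem iteratedFDeriv_two_quadratic' (A : E →L[ℝ] E) (x v w : E) :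
    iteratedFDeriv ℝ 2 (fun z : E => ⟪z, A z⟫) x ![v, w] = ⟪v, A w⟫ + ⟪A v, w⟫ := by
  rw [iteratedFDeriv_two_apply, fderiv_quadratic, ContinuousLinearMap.fderiv]
  simp only [Matrix.cons_val_zero, Matrix.cons_val_one, _root_.add_apply, ContinuousLinearMap.coe_comp,
    Function.comp_apply, ContinuousLinearMap.flip_apply, ContinuousLinearMap.compL_apply, innerSL_apply_apply]

/-- **THE HESSIAN OF `⟪·, A·⟫` IS `2A` FOR `A` SYMMETRIC**: `D²(z ↦ ⟪z, Az⟫)(x)[v, w] = 2⟪v, Aw⟫`. [folklore] -/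
theorem iteratedFDeriv_two_quadratic (A : E →L[ℝ] E) (hA : ∀ v w : E, ⟪A v, w⟫ = ⟪v, A w⟫) (x v w : E) :
    iteratedFDeriv ℝ 2 (fun z : E => ⟪z, A z⟫) x ![v, w] = 2 * ⟪v, A w⟫ := by
  rw [iteratedFDeriv_two_quadratic', hA, two_mul]

/-- The quadratic form of a bounded operator is `C^∞`. [folklore] -/
theorem contDiff_quadratic (A : E →L[ℝ] E) {k : WithTop ℕ∞} : ContDiff ℝ k (fun z : E => ⟪z, A z⟫) :=
  contDiff_id.inner ℝ A.contDiff

/-- **OPERATOR LETTER ⟹ HESSIAN FLOOR, EVERYWHERE**: `σ‖v‖² ≤ ⟪v, Av⟫` (`A` symmetric) ⟹ `2σ‖v‖² ≤ D²(⟪·, A·⟫)(x)[v, v]`. [folklore] -/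
theorem hessian_quadratic_lower (A : E →L[ℝ] E) (hA : ∀ v w : E, ⟪A v, w⟫ = ⟪v, A w⟫) {σ : ℝ}
    (hσ : ∀ v : E, σ * ‖v‖ ^ 2 ≤ ⟪v, A v⟫) (x v : E) :
    2 * σ * ‖v‖ ^ 2 ≤ iteratedFDeriv ℝ 2 (fun z : E => ⟪z, A z⟫) x ![v, v] := by
  rw [iteratedFDeriv_two_quadratic A hA]
  nlinarith [hσ v]

/-- … and the ceiling: `⟪v, Av⟫ ≤ Γ‖v‖²` ⟹ `D²(⟪·, A·⟫)(x)[v, v] ≤ 2Γ‖v‖²`. [folklore] -/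
theorem hessian_quadratic_upper (A : E →L[ℝ] E) (hA : ∀ v w : E, ⟪A v, w⟫ = ⟪v, A w⟫) {Γ : ℝ}
    (hΓ : ∀ v : E, ⟪v, A v⟫ ≤ Γ * ‖v‖ ^ 2) (x v : E) :
    iteratedFDeriv ℝ 2 (fun z : E => ⟪z, A z⟫) x ![v, v] ≤ 2 * Γ * ‖v‖ ^ 2 := by
  rw [iteratedFDeriv_two_quadratic A hA]
  nlinarith [hΓ v]

/-- **GAUSSIAN PLUS PERTURBATION, FLOOR ON A WINDOW**: `A` symmetric `σ`-coercive, `P` `C²` at the points of `K` with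
`−h‖v‖² ≤ D²P(x)[v, v]` on `K` ⊢ `(2σ − h)‖v‖² ≤ D²(⟪·, A·⟫ + P)(x)[v, v]` on `K`. [folklore] -/
theorem hessianOn_quadratic_add_lower (A : E →L[ℝ] E) (hA : ∀ v w : E, ⟪A v, w⟫ = ⟪v, A w⟫) {σ h : ℝ}
    (hσ : ∀ v : E, σ * ‖v‖ ^ 2 ≤ ⟪v, A v⟫) {P : E → ℝ} {K : Set E} (hP : ∀ x ∈ K, ContDiffAt ℝ 2 P x)
    (hPK : ∀ x ∈ K, ∀ v : E, -h * ‖v‖ ^ 2 ≤ iteratedFDeriv ℝ 2 P x ![v, v]) :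
    ∀ x ∈ K, ∀ v : E, (2 * σ - h) * ‖v‖ ^ 2 ≤ iteratedFDeriv ℝ 2 (fun z : E => ⟪z, A z⟫ + P z) x ![v, v] := by
  intro x hx v
  have e : (fun z : E => ⟪z, A z⟫ + P z) = (fun z : E => ⟪z, A z⟫) + P := rfl
  rw [e, iteratedFDeriv_add_apply (contDiff_quadratic A).contDiffAt (hP x hx), _root_.add_apply,
    iteratedFDeriv_two_quadratic A hA]
  have h1 := hσ v
  have h2 := hPK x hx v
  nlinarith

/-- … and the CEILING on a window: `⟪v, Av⟫ ≤ Γ‖v‖²`, `D²P(x)[v, v] ≤ h′‖v‖²` on `K` ⊢ `D²(⟪·, A·⟫ + P)(x)[v, v] ≤ (2Γ + h′)‖v‖²` on `K`.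
[folklore] -/
theorem hessianOn_quadratic_add_upper (A : E →L[ℝ] E) (hA : ∀ v w : E, ⟪A v, w⟫ = ⟪v, A w⟫) {Γ h' : ℝ}
    (hΓ : ∀ v : E, ⟪v, A v⟫ ≤ Γ * ‖v‖ ^ 2) {P : E → ℝ} {K : Set E} (hP : ∀ x ∈ K, ContDiffAt ℝ 2 P x)
    (hPK : ∀ x ∈ K, ∀ v : E, iteratedFDeriv ℝ 2 P x ![v, v] ≤ h' * ‖v‖ ^ 2) :
    ∀ x ∈ K, ∀ v : E, iteratedFDeriv ℝ 2 (fun z : E => ⟪z, A z⟫ + P z) x ![v, v] ≤ (2 * Γ + h') * ‖v‖ ^ 2 := by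
  intro x hx v
  have e : (fun z : E => ⟪z, A z⟫ + P z) = (fun z : E => ⟪z, A z⟫) + P := rfl
  rw [e, iteratedFDeriv_add_apply (contDiff_quadratic A).contDiffAt (hP x hx), _root_.add_apply,
    iteratedFDeriv_two_quadratic A hA]
  have h1 := hΓ v
  have h2 := hPK x hx v
  nlinarith

/-- The quadratic form of a SYMMETRIC operator along a chord: `a⟪x,Ax⟫ + b⟪y,Ay⟫ − ⟪ax+by, A(ax+by)⟫ = ab⟪x−y, A(x−y)⟫` for
`a + b = 1`. [folklore] -/
theorem quadratic_chord_identity (A : E →L[ℝ] E) (hA : ∀ v w : E, ⟪A v, w⟫ = ⟪v, A w⟫) (x y : E) {a b : ℝ}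
    (hab : a + b = 1) :
    a * ⟪x, A x⟫ + b * ⟪y, A y⟫ - ⟪a • x + b • y, A (a • x + b • y)⟫ = a * b * ⟪x - y, A (x - y)⟫ := by
  have hb : b = 1 - a := by linarith
  subst hb
  have hyx : ⟪y, A x⟫ = ⟪x, A y⟫ := by rw [← hA x y, real_inner_comm]
  simp only [map_add, map_smul, map_sub, inner_add_left, inner_add_right, inner_sub_left, inner_sub_right,
    real_inner_smul_left, real_inner_smul_right, hyx]
  ring

/-- **OPERATOR LETTER ⟹ STRONG CONVEXITY (secant currency)**: `σ‖v‖² ≤ ⟪v, Av⟫` (`A` symmetric) ⟹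
`StrongConvexOn univ (2σ) (z ↦ ⟪z, Az⟫)` — Mathlib's modulus currency (the input of `…ConvexityModulusTransport`, `…LogConcaveMarginal` §5's
round trip, `…FluctuationStepModulus`; restrict to a convex window with (27) `…ConvexityModulusTransport.strongConvexOn_subset`). [folklore] -/
theorem strongConvexOn_quadratic (A : E →L[ℝ] E) (hA : ∀ v w : E, ⟪A v, w⟫ = ⟪v, A w⟫) {σ : ℝ}
    (hσ : ∀ v : E, σ * ‖v‖ ^ 2 ≤ ⟪v, A v⟫) : StrongConvexOn univ (2 * σ) (fun z : E => ⟪z, A z⟫) := by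
  refine ⟨convex_univ, fun x _ y _ a b ha hb hab => ?_⟩
  have key := quadratic_chord_identity A hA x y hab
  have h1 := mul_le_mul_of_nonneg_left (hσ (x - y)) (mul_nonneg ha hb)
  simp only [smul_eq_mul]
  nlinarith [key, h1]

end Quadratic

/-! ## §3 Re-indexing transports the matrix letters (print's index set `Site P j` → the road's `Fin N`) -/

section Reindex

variable {ι κ : Type*} [Fintype ι] [Fintype κ]

/-- `(x ∘ e) ⬝ᵥ (y ∘ e) = x ⬝ᵥ y` along an index equivalence. [folklore] -/
theorem dotProduct_comp_equiv (e : ι ≃ κ) (x y : κ → ℝ) : (x ∘ e) ⬝ᵥ (y ∘ e) = x ⬝ᵥ y := by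
  simp only [dotProduct, Function.comp_apply]
  exact e.sum_comp (fun j => x j * y j)

/-- The form of a re-indexed matrix: `x ⬝ᵥ (reindex e e M) x = (x ∘ e) ⬝ᵥ M (x ∘ e)`. [folklore] -/
theorem dotProduct_reindex_mulVec (e : ι ≃ κ) (M : Matrix ι ι ℝ) (x : κ → ℝ) :
    x ⬝ᵥ ((reindex e e M) *ᵥ x) = (x ∘ e) ⬝ᵥ (M *ᵥ (x ∘ e)) := by
  rw [reindex_apply, submatrix_mulVec_equiv, Equiv.symm_symm, ← dotProduct_comp_equiv e.symm]
  congr 1; funext i; simp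

/-- **COERCIVITY TRANSPORTS ALONG INDEX EQUIVALENCES**: `Coercive (reindex e e M) γ ↔ Coercive M γ`. [folklore] -/
theorem coercive_reindex_iff (e : ι ≃ κ) (M : Matrix ι ι ℝ) (γ : ℝ) :
    QGQInverse.Coercive (reindex e e M) γ ↔ QGQInverse.Coercive M γ := by
  constructor
  · intro h y
    have hy := h (y ∘ e.symm)
    rw [dotProduct_reindex_mulVec, dotProduct_comp_equiv] at hy
    have hc : (y ∘ e.symm) ∘ e = y := by funext i; simp
    rwa [hc] at hy
  · intro h x
    rw [dotProduct_reindex_mulVec, ← dotProduct_comp_equiv e x x]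
    exact h _

/-- The UPPER form bound transports along index equivalences. [folklore] -/
theorem form_le_reindex (e : ι ≃ κ) {M : Matrix ι ι ℝ} {γ₁ : ℝ} (h : ∀ u : ι → ℝ, u ⬝ᵥ (M *ᵥ u) ≤ γ₁ * (u ⬝ᵥ u))
    (x : κ → ℝ) : x ⬝ᵥ ((reindex e e M) *ᵥ x) ≤ γ₁ * (x ⬝ᵥ x) := by
  rw [dotProduct_reindex_mulVec, ← dotProduct_comp_equiv e x x]
  exact h _

omit [Fintype ι] [Fintype κ] in
/-- Symmetry transports along index equivalences. [folklore] -/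
theorem isSymm_reindex (e : ι ≃ κ) {M : Matrix ι ι ℝ} (hM : M.IsSymm) : (reindex e e M).IsSymm := by
  rw [reindex_apply]
  exact hM.submatrix _

end Reindex

end Summit.QuantumFields.BalabanUV.T4Continuum.NE7b.ScalarTowerFibreFloor

/-! ## §4 BY VALUE: Bałaban's scalar torus tower — `Carg P a m² j = aL⁻²Q^*_jQ_j + Δ^{(j)}`, floor `gamma115u L a` ([B4] (1.15) on the torus) -/

namespace Summit.QuantumFields.BalabanUV.T4Continuum.NE7b.ScalarTowerFibreFloor

open Literature.MathematicalPhysics.QuantumFieldTheory.Balaban1983to89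
open Literature.MathematicalPhysics.QuantumFieldTheory.Balaban1983to89.B1RG242Torus
open Literature.MathematicalPhysics.QuantumFieldTheory.Balaban1983to89.B4Ineq115Torus

section ScalarTower

variable (P : Params)

/-- **THE FIBRE FLOOR BY VALUE, MATRIX CURRENCY**: `Coercive (aL⁻²Q^*Q + Δ^{(j)}) (gamma115u L a)` for every `a > 0`, `m² ≥ 0`,
level `j ≥ 1` (and every dimension ∕ volume ∕ cutoff packed in `P`) — [B4] (1.15) lower bound ON THE TORUS, the tree's
`B4Ineq115Torus.ineq115_lower_uniform` ([B4] (1.15) p. 574) BY NAME. [tree theorem by name; junction] -/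
theorem coercive_Carg {a msq : ℝ} (ha : 0 < a) (hm : 0 ≤ msq) {j : ℕ} (hj : 1 ≤ j) :
    QGQInverse.Coercive (Carg P a msq j) (gamma115u P.L a) :=
  fun ψ => ineq115_lower_uniform ha hm hj ψ

/- The CEILING `⟨ψ, Carg ψ⟩ ≤ (aL⁻² + a)‖ψ‖²` IS the tree's `B4Ineq115Torus.ineq115_upper` — consumed below by name, not restated. -/

/-- The Gaussian exponent's own operator `½(aL⁻²Q^*Q + Δ^{(j)})` is `(gamma115u L a)∕2`-coercive. [folklore] -/
theorem coercive_half_Carg {a msq : ℝ} (ha : 0 < a) (hm : 0 ≤ msq) {j : ℕ} (hj : 1 ≤ j) :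
    QGQInverse.Coercive ((1 / 2 : ℝ) • Carg P a msq j) (gamma115u P.L a / 2) := by
  have h := coercive_smul_of_nonneg (t := 1 / 2) (by norm_num) (coercive_Carg P ha hm hj)
  rwa [one_div_mul_eq_div] at h

/-- `½Carg` is symmetric. [folklore] -/
theorem isSymm_half_Carg (a msq : ℝ) (j : ℕ) : ((1 / 2 : ℝ) • Carg P a msq j).IsSymm :=
  (Carg_isSymm (P := P) a msq j).smul _

/-- **OPERATOR CURRENCY, THE `hσ` LETTER BY VALUE**: `gamma115u L a · ‖v‖² ≤ ⟪v, Ĉ v⟫` on `EuclideanSpace ℝ (Site P j)`,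
`Ĉ = toEuclideanCLM (Carg P a m² j)`. [folklore] (dictionary §1 + `coercive_Carg`) -/
theorem inner_Carg_lower {a msq : ℝ} (ha : 0 < a) (hm : 0 ≤ msq) {j : ℕ} (hj : 1 ≤ j) (v : EuclideanSpace ℝ (Site P j)) :
    gamma115u P.L a * ‖v‖ ^ 2 ≤ ⟪v, toEuclideanCLM (𝕜 := ℝ) (Carg P a msq j) v⟫ :=
  (coercive_iff_inner _ _).1 (coercive_Carg P ha hm hj) v

/-- **OPERATOR CURRENCY, THE `hΓ` LETTER BY VALUE**: `⟪v, Ĉ v⟫ ≤ (aL⁻² + a)‖v‖²`. [folklore] -/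
theorem inner_Carg_upper {a msq : ℝ} (ha : 0 < a) (hm : 0 ≤ msq) {j : ℕ} (hj : 1 ≤ j) (v : EuclideanSpace ℝ (Site P j)) :
    ⟪v, toEuclideanCLM (𝕜 := ℝ) (Carg P a msq j) v⟫ ≤ (a * ((P.L : ℝ) ^ 2)⁻¹ + a) * ‖v‖ ^ 2 :=
  inner_le_of_form_le (fun u => ineq115_upper ha hm hj u) v

/-- **OPERATOR CURRENCY, THE `hA` LETTER**: `Ĉ` is symmetric. [folklore] -/
theorem inner_Carg_symm (a msq : ℝ) (j : ℕ) (v w : EuclideanSpace ℝ (Site P j)) :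
    ⟪toEuclideanCLM (𝕜 := ℝ) (Carg P a msq j) v, w⟫ = ⟪v, toEuclideanCLM (𝕜 := ℝ) (Carg P a msq j) w⟫ :=
  inner_toEuclideanCLM_symm (Carg_isSymm (P := P) a msq j) v w

/-- **HESSIAN CURRENCY, THE FIBRE FLOOR BY VALUE**: `2·gamma115u L a·‖v‖² ≤ D²(z ↦ ⟪z, Ĉ z⟫)(x)[v, v]` at every point. [folklore] -/
theorem hessian_Carg_lower {a msq : ℝ} (ha : 0 < a) (hm : 0 ≤ msq) {j : ℕ} (hj : 1 ≤ j) (x v : EuclideanSpace ℝ (Site P j)) :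
    2 * gamma115u P.L a * ‖v‖ ^ 2 ≤
      iteratedFDeriv ℝ 2 (fun z : EuclideanSpace ℝ (Site P j) => ⟪z, toEuclideanCLM (𝕜 := ℝ) (Carg P a msq j) z⟫) x ![v, v] :=
  hessian_quadratic_lower _ (inner_Carg_symm P a msq j) (inner_Carg_lower P ha hm hj) x v

/-- **HESSIAN CURRENCY, THE CEILING BY VALUE**: `D²(z ↦ ⟪z, Ĉ z⟫)(x)[v, v] ≤ 2(aL⁻² + a)‖v‖²`. [folklore] -/
theorem hessian_Carg_upper {a msq : ℝ} (ha : 0 < a) (hm : 0 ≤ msq) {j : ℕ} (hj : 1 ≤ j) (x v : EuclideanSpace ℝ (Site P j)) :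
    iteratedFDeriv ℝ 2 (fun z : EuclideanSpace ℝ (Site P j) => ⟪z, toEuclideanCLM (𝕜 := ℝ) (Carg P a msq j) z⟫) x ![v, v] ≤
      2 * (a * ((P.L : ℝ) ^ 2)⁻¹ + a) * ‖v‖ ^ 2 :=
  hessian_quadratic_upper _ (inner_Carg_symm P a msq j) (inner_Carg_upper P ha hm hj) x v

/-- **THE PERTURBED GAUSSIAN FIBRE OF THE SCALAR TOWER, FLOOR ON A WINDOW**: for `V = ½⟪·, Ĉ·⟫ + Pt` with `Pt` `C²` at the points of
`K` and `−h‖v‖² ≤ D²Pt` on `K`: `(gamma115u L a − h)‖v‖² ≤ D²V(x)[v, v]` on `K` — the `hfib` ∕ `hH` shape of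
`…FibreWindowHessianBounds` §9 ∕ `…HessianFormFirstOrder` with `λ := gamma115u L a − h` BY VALUE. [folklore] -/
theorem hessianOn_half_Carg_add_lower {a msq : ℝ} (ha : 0 < a) (hm : 0 ≤ msq) {j : ℕ} (hj : 1 ≤ j) {h : ℝ}
    {Pt : EuclideanSpace ℝ (Site P j) → ℝ} {K : Set (EuclideanSpace ℝ (Site P j))} (hP : ∀ x ∈ K, ContDiffAt ℝ 2 Pt x)
    (hPK : ∀ x ∈ K, ∀ v, -h * ‖v‖ ^ 2 ≤ iteratedFDeriv ℝ 2 Pt x ![v, v]) :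
    ∀ x ∈ K, ∀ v, (gamma115u P.L a - h) * ‖v‖ ^ 2 ≤
      iteratedFDeriv ℝ 2 (fun z : EuclideanSpace ℝ (Site P j) =>
        ⟪z, toEuclideanCLM (𝕜 := ℝ) ((1 / 2 : ℝ) • Carg P a msq j) z⟫ + Pt z) x ![v, v] := by
  intro x hx v
  have h := hessianOn_quadratic_add_lower (toEuclideanCLM (𝕜 := ℝ) ((1 / 2 : ℝ) • Carg P a msq j))
    (inner_toEuclideanCLM_symm (isSymm_half_Carg P a msq j))
    ((coercive_iff_inner _ _).1 (coercive_half_Carg P ha hm hj)) hP hPK x hx v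
  linarith

/-- **SECANT CURRENCY, THE FIBRE FLOOR BY VALUE**: the Gaussian part `⟪Z, (½Ĉ) Z⟫ = ½⟨Z, C^{(j)−1}Z⟩` of the scalar tower's fibre
exponent is `gamma115u L a`-strongly convex on the whole fluctuation space — the `StrongConvexOn` input of (26) §5's round trip ∕
leaf-03's `…StrongConvexFirstOrderWithin` (⟹ the first-order fibre letter of `…FibreWindowHessianBounds` §5) and of (27)'s transport.
(In print's step `Carg = Δ^{(j)} + aL⁻²Q^*Q` is the FIBRE Hessian of the joint exponent `½⟨φ, Δ^{(j)}φ⟩ + (aL⁻²∕2)‖ψ − Qφ‖²` in the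
integrated variable `φ`; the RG kernel's own modulus `aL⁻²` — the `a` of (30) `…FluctuationStepModulus` — needs no estimate.)
[folklore] (§2 `strongConvexOn_quadratic` + `coercive_half_Carg`) -/
theorem strongConvexOn_half_Carg {a msq : ℝ} (ha : 0 < a) (hm : 0 ≤ msq) {j : ℕ} (hj : 1 ≤ j) :
    StrongConvexOn univ (gamma115u P.L a)
      (fun z : EuclideanSpace ℝ (Site P j) => ⟪z, toEuclideanCLM (𝕜 := ℝ) ((1 / 2 : ℝ) • Carg P a msq j) z⟫) := by
  have h := strongConvexOn_quadratic (toEuclideanCLM (𝕜 := ℝ) ((1 / 2 : ℝ) • Carg P a msq j))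
    (inner_toEuclideanCLM_symm (isSymm_half_Carg P a msq j)) ((coercive_iff_inner _ _).1 (coercive_half_Carg P ha hm hj))
  have e : 2 * (gamma115u P.L a / 2) = gamma115u P.L a := by ring
  rwa [e] at h

/-- **`Fin N` CURRENCY** (the index set of `…CoerciveFluctuationFloor` §3–§5): along ANY enumeration `e : Site P j ≃ Fin N` the
re-indexed matrix is `gamma115u L a`-coercive … [folklore] (§3 + `coercive_Carg`) -/
theorem coercive_Carg_reindex {a msq : ℝ} (ha : 0 < a) (hm : 0 ≤ msq) {j N : ℕ} (hj : 1 ≤ j) (e : Site P j ≃ Fin N) :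
    QGQInverse.Coercive (reindex e e (Carg P a msq j)) (gamma115u P.L a) :=
  (coercive_reindex_iff e _ _).2 (coercive_Carg P ha hm hj)

/-- … bounded above by `aL⁻² + a` … [folklore] -/
theorem form_le_Carg_reindex {a msq : ℝ} (ha : 0 < a) (hm : 0 ≤ msq) {j N : ℕ} (hj : 1 ≤ j) (e : Site P j ≃ Fin N)
    (x : Fin N → ℝ) : x ⬝ᵥ ((reindex e e (Carg P a msq j)) *ᵥ x) ≤ (a * ((P.L : ℝ) ^ 2)⁻¹ + a) * (x ⬝ᵥ x) :=
  form_le_reindex e (fun u => ineq115_upper ha hm hj u) x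

/-- … and symmetric. [folklore] -/
theorem isSymm_Carg_reindex (a msq : ℝ) {j N : ℕ} (e : Site P j ≃ Fin N) : (reindex e e (Carg P a msq j)).IsSymm :=
  isSymm_reindex e (Carg_isSymm (P := P) a msq j)

end ScalarTower

/-- **PRINT'S QUANTIFIER ORDER** (mirroring `B4Ineq116Torus.cov116_torus` ∕ `…InducedMeanScalarTower` §2): for every odd `L > 1` and
every `a > 0` THERE IS `γ₀ > 0` — namely `gamma115u L a`, a function of `L` and `a` ONLY — such that for EVERY dimension `d ≥ 1`,
volume `m`, cutoff `K`, mass `m² ≥ 0` and level `j ≥ 1` the fibre quadratic form of the scalar tower's fluctuation covariance is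
`γ₀`-coercive in the road's operator currency: (ℓ1) «independent of `k` and of the volume» for the scalar prototype, as a theorem.
[folklore] (junction; the estimate is the tree's (1.15) on the torus) -/
theorem fibreFloor_scalarTower_uniform (L : ℕ) (hL : Odd L ∧ 1 < L) {a : ℝ} (ha : 0 < a) :
    ∃ γ₀ : ℝ, 0 < γ₀ ∧ ∀ (d m K : ℕ) (hd : 1 ≤ d) (msq : ℝ), 0 ≤ msq → ∀ (j : ℕ), 1 ≤ j →
      ∀ v : EuclideanSpace ℝ (Site (⟨d, L, m, K, hd, hL⟩ : Params) j),
        γ₀ * ‖v‖ ^ 2 ≤ ⟪v, toEuclideanCLM (𝕜 := ℝ) (Carg (⟨d, L, m, K, hd, hL⟩ : Params) a msq j) v⟫ :=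
  ⟨gamma115u L a, gamma115u_pos ha (Nat.one_lt_cast.mpr hL.2), fun d m K hd _ hm _ hj v =>
    inner_Carg_lower ⟨d, L, m, K, hd, hL⟩ ha hm hj v⟩

/-! ## §5 Toy (kernel): the hypotheses are jointly inhabited -/

/-- `L = 3` is odd and `> 1` (a concrete `Params := ⟨1, 3, 1, 1, _, _⟩`). -/
private theorem hL3 : Odd 3 ∧ 1 < 3 := ⟨⟨1, rfl⟩, by norm_num⟩

/-- Toy: `d = 1`, `L = 3`, `m = K = 1`, `a = 1`, `m² = 0`, `j = 1`: the Hessian floor `2·gamma115u 3 1` of `⟪·, Ĉ·⟫` everywhere. -/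
example (x v : EuclideanSpace ℝ (Site (⟨1, 3, 1, 1, le_rfl, hL3⟩ : Params) 1)) :
    2 * gamma115u ((⟨1, 3, 1, 1, le_rfl, hL3⟩ : Params).L) 1 * ‖v‖ ^ 2 ≤
      iteratedFDeriv ℝ 2 (fun z => ⟪z, toEuclideanCLM (𝕜 := ℝ) (Carg (⟨1, 3, 1, 1, le_rfl, hL3⟩ : Params) 1 0 1) z⟫) x ![v, v] :=
  hessian_Carg_lower _ one_pos le_rfl le_rfl x v

end Summit.QuantumFields.BalabanUV.T4Continuum.NE7b.ScalarTowerFibreFloor
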